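import Summits.Ventures.HSemireg.WedgeHankelRecurrenceGaussRadau

/-!
# Venture HSemireg — **THE REPRODUCING KERNEL AND SZEGŐ'S FORMULA `λ_ν = 1/K_n(x_ν, x_ν)`**: for an orthogonal system `q_0, …, q_m` of a discrete measure `(ν, w)` (`q_k` monic of degree `k`,
# orthogonal to lower degrees, `h_k = Σ ν q_k² ≠ 0`) the kernel `K_n(x, y) = Σ_{k ≤ n} q_k(x) q_k(y)/h_k` REPRODUCES polynomials of degree `≤ n`: `Σ_l ν_l K_n(w_l, y) P(w_l) = P(y)`; and if
# `(μ, x)` is a `(t+1)`-point rule exact in degree `≤ 2t`, then `μ_k · K_t(x_k, x_k) = 1` — the Christoffel numbers are the reciprocals of the kernel on the diagonal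

HONEST FRAMING. Part of the Lean index of the computation cell `pub-hsemireg` (seat p10 gen 42, Sunday typer «UNIFORM-IN-n»).  Real polynomials and finite sums only; no variety, no
cohomology theory, no sheaf, no Ext group and no semiregularity map is constructed here; nothing here says that HC / HC_CM / HC_AV holds; no Literature fact (unproved `Prop`) is declared or
used.  Custodian versions as in `WedgeHankelSiegelIdeal` (1/3).
SOURCES (cited).  G. Szegő, *Orthogonal Polynomials*, AMS Colloq. Publ. 23, §3.1 (3.1.9)–(3.1.12) (kernel polynomials and the reproducing property) and Thm 3.4.2 (3.4.8)
(`λ_ν^{-1} = Σ_{k=0}^{n} p_k(x_ν)² = K_n(x_ν, x_ν)`); T. S. Chihara, *An Introduction to Orthogonal Polynomials* (1978), Ch. I §7 (kernel polynomials) and (6.5)–(6.6); N265 of this lineage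
(`λ_ν = ∫ ℓ_ν² dα`).
PROOF TYPED HERE.  Reproducing: induction on `n`; `P = c q_{n+1} + P′` with `deg P′ ≤ n`, `K_{n+1}(·, y) = K_n(·, y) + q_{n+1}(y) q_{n+1}/h_{n+1}`, `K_n(·, y) ⊥ q_{n+1}` (degree `≤ n`), `q_{n+1} ⊥ P′`.
Szegő's formula: apply the reproducing property to `P = ℓ_k`, `y = x_k` and evaluate the left side by the Gauss rule (degree `≤ 2t`): only the node `x_k` survives.
DEDUP DISCLOSURE (`rg -n 'reproduc|kernelPoly' Summits/Ventures/HSemireg/WedgeHankelRecurrence*`, 2026-09-02): N267 ∕ N268 use «kernel polynomial» for the shifted rule's node polynomial only;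
nothing on the reproducing kernel (the short name `natDegree_kernelPoly_le` is taken under HodgeRepro2 ∕ PadicSigmaThree for other kernel polynomials — hence `reproducingKernel`
here).  The 5 names below: 0 hits tree-wide.

WHAT IS IN THE TREE.  N262 `sum_mul_eval_eq_of_moments_eq`; N265 `natDegree_lagrange_basis_fin`, `sum_mul_eval_lagrange_basis_pow`; N269 `natDegree_sub_C_mul_le_of_monic`; Mathlib
`Lagrange.basis`, `Finset.sum_range_succ`, `Polynomial.eq_one_of_monic_natDegree_zero`.
THIS FILE (namespace `Summit.Ventures.HSemireg.Wedge.HankelOuter` continued; CHAINED on N276 (import), N265, N269; 0 definitions — the kernel is spelled out inline):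
* §1042 `natDegree_reproducingKernel_le` (`deg_x K_n(x, y) ≤ n`), `sum_mul_eval_reproducingKernel_mul_orthogonal` (`K_n(·, y) ⊥ q_{n+1}`), **`kernel_reproducing`** (THE REPRODUCING PROPERTY),
  `kernel_reproducing_eval` (pointwise form `Σ_l ν_l K_n(w_l, y) P(w_l) = P(y)`), **`gauss_weight_mul_kernel_diag_eq_one`** (SZEGŐ (3.4.8): `μ_k · Σ_{j ≤ t} q_j(x_k)²/h_j = 1`).
CAVEATS.  The orthogonal system is ASSUMED (hypotheses for `k ≤ m`); nothing Ext-side.  New names only.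
-/

open Module Polynomial
open scoped Matrix Polynomial

namespace Summit.Ventures.HSemireg.Wedge.HankelOuter

/-! ## §1042. The reproducing kernel -/

/-- `deg_x K_n(x, y) ≤ n` for the kernel polynomial `K_n(·, y) = Σ_{k ≤ n} (q_k(y)/h_k) q_k` when `deg q_k = k`. [bookkeeping; this file, §1042] -/
theorem natDegree_reproducingKernel_le {N n : ℕ} {ν w : Fin N → ℝ} {q : ℕ → ℝ[X]} (hdeg : ∀ k, k ≤ n → (q k).natDegree = k) (y : ℝ) :
    (∑ k ∈ Finset.range (n + 1), C ((q k).eval y / ∑ l, ν l * ((q k).eval (w l)) ^ 2) * q k).natDegree ≤ n := by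
  refine natDegree_sum_le_of_forall_le _ _ fun k hk => ?_
  refine (natDegree_C_mul_le _ _).trans ?_
  rw [hdeg k (by have := Finset.mem_range.1 hk; omega)]
  have := Finset.mem_range.1 hk; omega

/-- `K_n(·, y) ⊥ q_{n+1}`: `Σ_l ν_l K_n(w_l, y) q_{n+1}(w_l) = 0`. [Szegő §3.1; this file, §1042] -/
theorem sum_mul_eval_reproducingKernel_mul_orthogonal {N n : ℕ} {ν w : Fin N → ℝ} {q : ℕ → ℝ[X]} (hdeg : ∀ k, k ≤ n → (q k).natDegree = k)
    (horth : ∀ G : ℝ[X], G.natDegree < n + 1 → ∑ l, ν l * (q (n + 1) * G).eval (w l) = 0) (y : ℝ) :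
    ∑ l, ν l * ((∑ k ∈ Finset.range (n + 1), C ((q k).eval y / ∑ l, ν l * ((q k).eval (w l)) ^ 2) * q k) * q (n + 1)).eval (w l) = 0 := by
  rw [mul_comm]
  exact horth _ (Nat.lt_succ_of_le (natDegree_reproducingKernel_le (ν := ν) (w := w) hdeg y))

/-- **THE REPRODUCING PROPERTY**: let `q_k` (`k ≤ m`) be monic of degree `k`, `(ν, w)`-orthogonal to all polynomials of degree `< k`, with `h_k = Σ_l ν_l q_k(w_l)² ≠ 0`.  Then for `n ≤ m`,
every `P` with `deg P ≤ n` and every `y`:  `Σ_l ν_l K_n(w_l, y) P(w_l) = P(y)`,  `K_n(·, y) = Σ_{k ≤ n} (q_k(y)/h_k) q_k`. [Szegő §3.1 (3.1.9)–(3.1.12); Chihara I §7; this file, §1042] -/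
theorem kernel_reproducing {N m : ℕ} {ν w : Fin N → ℝ} {q : ℕ → ℝ[X]} (hmonic : ∀ k, k ≤ m → (q k).Monic) (hdeg : ∀ k, k ≤ m → (q k).natDegree = k)
    (horth : ∀ k, k ≤ m → ∀ G : ℝ[X], G.natDegree < k → ∑ l, ν l * (q k * G).eval (w l) = 0) (hh : ∀ k, k ≤ m → ∑ l, ν l * ((q k).eval (w l)) ^ 2 ≠ 0)
    {n : ℕ} (hn : n ≤ m) {P : ℝ[X]} (hP : P.natDegree ≤ n) (y : ℝ) :
    ∑ l, ν l * ((∑ k ∈ Finset.range (n + 1), C ((q k).eval y / ∑ l, ν l * ((q k).eval (w l)) ^ 2) * q k) * P).eval (w l) = P.eval y := by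
  induction n generalizing P with
  | zero =>
    have hq0 : q 0 = 1 := eq_one_of_monic_natDegree_zero (hmonic 0 hn) (hdeg 0 hn)
    have hh0 := hh 0 hn
    rw [hq0] at hh0
    simp only [eval_one, one_pow, mul_one] at hh0
    obtain ⟨p, hp⟩ : ∃ p : ℝ, P = C p := ⟨P.coeff 0, eq_C_of_natDegree_le_zero hP⟩
    subst hp
    simp only [zero_add, Finset.sum_range_one, hq0, eval_one, one_pow, mul_one, eval_mul, eval_C]
    rw [← Finset.sum_mul]
    field_simp
  | succ n ih =>
    have hn' : n ≤ m := by omega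
    set c : ℝ := P.coeff (n + 1) with hc
    set P' : ℝ[X] := P - C c * q (n + 1) with hP'
    have hP'd : P'.natDegree ≤ n := by
      have := natDegree_sub_C_mul_le_of_monic hP (hmonic (n + 1) hn) (hdeg (n + 1) hn)
      simpa using this
    have ih' := ih hn' hP'd
    set Kn : ℝ[X] := ∑ k ∈ Finset.range (n + 1), C ((q k).eval y / ∑ l, ν l * ((q k).eval (w l)) ^ 2) * q k with hKn
    set a : ℝ := (q (n + 1)).eval y / ∑ l, ν l * ((q (n + 1)).eval (w l)) ^ 2 with ha
    rw [Finset.sum_range_succ]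
    -- the two orthogonality relations
    have hK0 : ∑ l, ν l * (Kn * q (n + 1)).eval (w l) = 0 := sum_mul_eval_reproducingKernel_mul_orthogonal (fun k hk => hdeg k (by omega)) (horth (n + 1) hn) y
    have hq0 : ∑ l, ν l * (q (n + 1) * P').eval (w l) = 0 := horth (n + 1) hn P' (by omega)
    -- expand term by term
    have hP'ev : ∀ z, P.eval z = P'.eval z + c * (q (n + 1)).eval z := fun z => by rw [hP', eval_sub, eval_mul, eval_C]; ring
    have e : ∀ l, ν l * ((Kn + C a * q (n + 1)) * P).eval (w l)
        = ν l * (Kn * P').eval (w l) + c * (ν l * (Kn * q (n + 1)).eval (w l)) + a * (ν l * (q (n + 1) * P').eval (w l)) + a * c * (ν l * ((q (n + 1)).eval (w l)) ^ 2) := fun l => by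
      simp only [eval_add, eval_mul, eval_C, hP'ev (w l)]
      ring
    rw [Finset.sum_congr rfl fun l _ => e l, Finset.sum_add_distrib, Finset.sum_add_distrib, Finset.sum_add_distrib, ← Finset.mul_sum, ← Finset.mul_sum, ← Finset.mul_sum,
      ih', hK0, hq0, mul_zero, mul_zero, add_zero, add_zero, hP'ev y]
    have hS : (∑ l, ν l * ((q (n + 1)).eval (w l)) ^ 2) ≠ 0 := hh (n + 1) hn
    have hfin : a * c * ∑ l, ν l * ((q (n + 1)).eval (w l)) ^ 2 = c * (q (n + 1)).eval y := by
      rw [ha]; field_simp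
    rw [hfin]

/-- **The reproducing property, pointwise**: `Σ_l ν_l K_n(w_l, y) P(w_l) = P(y)` with `K_n(x, y) = Σ_{k ≤ n} q_k(x) q_k(y)/h_k`. [Szegő §3.1; this file, §1042] -/
theorem kernel_reproducing_eval {N m : ℕ} {ν w : Fin N → ℝ} {q : ℕ → ℝ[X]} (hmonic : ∀ k, k ≤ m → (q k).Monic) (hdeg : ∀ k, k ≤ m → (q k).natDegree = k)
    (horth : ∀ k, k ≤ m → ∀ G : ℝ[X], G.natDegree < k → ∑ l, ν l * (q k * G).eval (w l) = 0) (hh : ∀ k, k ≤ m → ∑ l, ν l * ((q k).eval (w l)) ^ 2 ≠ 0)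
    {n : ℕ} (hn : n ≤ m) {P : ℝ[X]} (hP : P.natDegree ≤ n) (y : ℝ) :
    ∑ l, ν l * ((∑ k ∈ Finset.range (n + 1), (q k).eval (w l) * (q k).eval y / ∑ l, ν l * ((q k).eval (w l)) ^ 2) * P.eval (w l)) = P.eval y := by
  rw [← kernel_reproducing hmonic hdeg horth hh hn hP y]
  refine Finset.sum_congr rfl fun l _ => ?_
  rw [eval_mul, eval_finsetSum]
  congr 2
  exact Finset.sum_congr rfl fun k _ => by rw [eval_mul, eval_C]; ring

/-- **SZEGŐ'S FORMULA (3.4.8): `λ_ν · K_n(x_ν, x_ν) = 1`.**  If `q_0, …, q_t` is an orthogonal system of `(ν, w)` as above and the `(t+1)`-point rule `(μ, x)` (distinct nodes) is exact in degree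
`≤ 2t` against `(ν, w)`, then `μ_k · Σ_{j ≤ t} q_j(x_k)²/h_j = 1` for every node. [Szegő Thm 3.4.2 (3.4.8); Chihara I (6.5); this file, §1042] -/
theorem gauss_weight_mul_kernel_diag_eq_one {N t : ℕ} {ν w : Fin N → ℝ} {q : ℕ → ℝ[X]} (hmonic : ∀ k, k ≤ t → (q k).Monic) (hdeg : ∀ k, k ≤ t → (q k).natDegree = k)
    (horth : ∀ k, k ≤ t → ∀ G : ℝ[X], G.natDegree < k → ∑ l, ν l * (q k * G).eval (w l) = 0) (hh : ∀ k, k ≤ t → ∑ l, ν l * ((q k).eval (w l)) ^ 2 ≠ 0)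
    {μ x : Fin (t + 1) → ℝ} (hx : Function.Injective x) (hmom : ∀ p, p ≤ 2 * t → ∑ j, μ j * x j ^ p = ∑ l, ν l * w l ^ p) (k : Fin (t + 1)) :
    μ k * ∑ j ∈ Finset.range (t + 1), ((q j).eval (x k)) ^ 2 / ∑ l, ν l * ((q j).eval (w l)) ^ 2 = 1 := by
  set L := Lagrange.basis Finset.univ x k with hL
  set K : ℝ[X] := ∑ j ∈ Finset.range (t + 1), C ((q j).eval (x k) / ∑ l, ν l * ((q j).eval (w l)) ^ 2) * q j with hK
  have hrep := kernel_reproducing hmonic hdeg horth hh le_rfl (P := L) (natDegree_lagrange_basis_fin hx k).le (x k)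
  rw [Lagrange.eval_basis_self (hx.injOn.mono (Set.subset_univ _)) (Finset.mem_univ k)] at hrep
  -- evaluate the left side by the Gauss rule
  have hdegKL : (K * L).natDegree < 2 * t + 1 := by
    refine lt_of_le_of_lt natDegree_mul_le ?_
    have h1 := natDegree_reproducingKernel_le (ν := ν) (w := w) hdeg (x k)
    rw [natDegree_lagrange_basis_fin hx k]
    have : K.natDegree ≤ t := h1
    omega
  have hq := sum_mul_eval_eq_of_moments_eq (N := 2 * t + 1) (fun p hp => hmom p (by omega)) hdegKL
  rw [← hq] at hrep
  -- only the node `x_k` survives on the small side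
  rw [Finset.sum_eq_single k (fun j _ hjk => by
      rw [eval_mul, hL, Lagrange.eval_basis_of_ne (Ne.symm hjk) (Finset.mem_univ j), mul_zero, mul_zero]) (fun h => absurd (Finset.mem_univ k) h),
    eval_mul, hL, Lagrange.eval_basis_self (hx.injOn.mono (Set.subset_univ _)) (Finset.mem_univ k), mul_one] at hrep
  rw [← hrep, hK, eval_finsetSum]
  congr 1
  exact Finset.sum_congr rfl fun j _ => by rw [eval_mul, eval_C]; ring

end Summit.Ventures.HSemireg.Wedge.HankelOuter
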